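import Mathlib.Data.Set.Card
import Mathlib.Data.Real.Basic
import Mathlib.Algebra.Order.BigOperators.Group.Finset
import Mathlib.Algebra.BigOperators.Ring.Finset
import Mathlib.Analysis.SpecialFunctions.Pow.Real
import Literature.ModelTheory.PseudofiniteFields.CountingDimension
import HarnessLib

/-!
# The fibre-counting dimension with explicit thresholds, and point counting in finite fields

Topic `Literature/ModelTheory/PseudofiniteFields`.  Companion of `CountingDimension.lean`.
The intrinsic predicate `DimAtLeast n X e` fibres `X ⊆ K^{n}` over its first `n − 1`
coordinates and asks whether fibres are FINITE or INFINITE.  Here the same recursion is run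
with "has at most `C_k` points" / "has more than `C_k` points" in place of finite / infinite,
for a sequence of thresholds `Cs : ℕ → ℕ` (`CDimAtLeast Cs n X e`); this version makes sense
in FINITE fields and is first-order expressible for definable `X`
(`CountingDimensionDefinable.lean`).

Over a finite field `F` with `q` elements, thresholds are **good** for `X`
(`GoodThresholds Cs δ n X`, `0 < δ ≤ 1`) when, all along the recursion, every fibre with more
than `C_k` points has at least `δ q` points — the dichotomy "`≤ C` or `≥ δ q`" that the Main
Theorem of [ChatzidakisVanDenDriesMacintyre1992] guarantees for the fibres of a definable family,
uniformly in the finite field (their existence for definable `X` is proved from that named fact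
in `CountingDimensionDefinable.lean`).  For good thresholds we prove the two **counting
estimates** that give the dimension its meaning:

* `le_ncard_of_cDimAtLeast`:  `CDimAtLeast Cs n X e → δ^n q^e ≤ |X|`;
* `ncard_le_of_not_cDimAtLeast`:  `¬ CDimAtLeast Cs n X (e+1) → |X| ≤ M_n q^e`,
  `M_0 = 1`, `M_{n+1} = (C_n + 1) M_n` (`thresholdBound`).

So in large finite fields "dimension `≥ e`" in the sense of `CDimAtLeast` means `|X| ≍ q^{≥ e}`
[ChatzidakisVanDenDriesMacintyre1992, Main Theorem: `|X| = μ q^d + O(q^{d − 1/2})`].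

## References

* [ChatzidakisVanDenDriesMacintyre1992] Z. Chatzidakis, L. van den Dries, A. Macintyre,
  Definable sets over finite fields, J. reine angew. Math. 427 (1992) 107–135, Main Theorem, §3.
-/

namespace Literature.ModelTheory.PseudofiniteFields

open Finset

variable {K : Type*}

section HasMoreThan

variable {α : Type*}

/-- `S` **has more than `C` elements**: there are `C + 1` pairwise distinct elements of `S`
(meaningful for infinite `S` too, and first-order for definable `S`). [folklore] -/
def HasMoreThan (C : ℕ) (S : Set α) : Prop :=
  ∃ w : Fin (C + 1) → α, Function.Injective w ∧ ∀ j, w j ∈ S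

/-- `HasMoreThan` is monotone in the set. [folklore] -/
theorem HasMoreThan.mono {C : ℕ} {S T : Set α} (h : HasMoreThan C S) (hST : S ⊆ T) :
    HasMoreThan C T := by
  obtain ⟨w, hw, hmem⟩ := h
  exact ⟨w, hw, fun j => hST (hmem j)⟩

/-- An infinite set has more than `C` elements for every `C`. [folklore] -/
theorem Set.Infinite.hasMoreThan {S : Set α} (hS : S.Infinite) (C : ℕ) : HasMoreThan C S := by
  obtain ⟨t, ht, hcard⟩ := hS.exists_subset_card_eq (C + 1)
  refine ⟨fun j => ((t.equivFinOfCardEq hcard).symm j).1, fun j j' h => ?_, fun j => ht ?_⟩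
  · exact (t.equivFinOfCardEq hcard).symm.injective (Subtype.ext h)
  · exact Finset.mem_coe.2 ((t.equivFinOfCardEq hcard).symm j).2

/-- For a finite set, "more than `C` elements" means `C < |S|`. [folklore] -/
theorem hasMoreThan_iff_lt_ncard {C : ℕ} {S : Set α} (hS : S.Finite) :
    HasMoreThan C S ↔ C < S.ncard := by
  classical
  constructor
  · rintro ⟨w, hw, hmem⟩
    have h1 : (Finset.univ.image w).card = C + 1 := by
      rw [Finset.card_image_of_injective _ hw, Finset.card_univ, Fintype.card_fin]
    have h2 : Finset.univ.image w ⊆ hS.toFinset := by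
      intro a ha
      obtain ⟨j, -, rfl⟩ := Finset.mem_image.1 ha
      exact hS.mem_toFinset.2 (hmem j)
    have h3 := Finset.card_le_card h2
    rw [h1, ← Set.ncard_eq_toFinset_card S hS] at h3
    exact h3
  · intro hC
    rw [Set.ncard_eq_toFinset_card S hS] at hC
    obtain ⟨t, ht, hcard⟩ := Finset.exists_subset_card_eq (Nat.succ_le_of_lt hC)
    refine ⟨fun j => ((t.equivFinOfCardEq hcard).symm j).1, fun j j' h => ?_, fun j => ?_⟩
    · exact (t.equivFinOfCardEq hcard).symm.injective (Subtype.ext h)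
    · exact hS.mem_toFinset.1 (ht ((t.equivFinOfCardEq hcard).symm j).2)

/-- For a finite set, "not more than `C` elements" means `|S| ≤ C`. [folklore] -/
theorem not_hasMoreThan_iff_ncard_le {C : ℕ} {S : Set α} (hS : S.Finite) :
    ¬ HasMoreThan C S ↔ S.ncard ≤ C := by
  rw [hasMoreThan_iff_lt_ncard hS, not_lt]

/-- A set with more than `C` elements is nonempty. [folklore] -/
theorem HasMoreThan.nonempty {C : ℕ} {S : Set α} (h : HasMoreThan C S) : S.Nonempty := by
  obtain ⟨w, -, hmem⟩ := h
  exact ⟨w 0, hmem 0⟩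

end HasMoreThan

section Defs

/-- The base of the fibres of `X ⊆ K^{n+1}` that are NONEMPTY with AT MOST `C` points
(the thresholded `finBase`). [folklore] -/
def cfinBase {n : ℕ} (C : ℕ) (X : Set (Fin (n + 1) → K)) : Set (Fin n → K) :=
  {p | (lastFibre X p).Nonempty ∧ ¬ HasMoreThan C (lastFibre X p)}

/-- The base of the fibres of `X ⊆ K^{n+1}` with MORE THAN `C` points (the thresholded
`infBase`). [folklore] -/
def cinfBase {n : ℕ} (C : ℕ) (X : Set (Fin (n + 1) → K)) : Set (Fin n → K) :=
  {p | HasMoreThan C (lastFibre X p)}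

/-- **The fibre-counting dimension with thresholds `Cs`** (`CDimAtLeast Cs n X e`): the
recursion of `DimAtLeast` with "more than `Cs k` points" in place of "infinite" for the fibres
met at level `k + 1`. [folklore] -/
def CDimAtLeast (Cs : ℕ → ℕ) : (n : ℕ) → Set (Fin n → K) → ℕ → Prop
  | 0, X, e => X.Nonempty ∧ e = 0
  | n + 1, X, e => CDimAtLeast Cs n (cfinBase (Cs n) X) e ∨ CDimAtLeast Cs n (cinfBase (Cs n) X) (e - 1)

/-- **Good thresholds** for `X ⊆ F^n` over a finite field `F` with `q` elements: all along the
recursion, a fibre with more than `Cs k` points has at least `δ q` points (the dichotomy of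
[ChatzidakisVanDenDriesMacintyre1992, Main Theorem] for the fibres). [folklore] -/
def GoodThresholds [Fintype K] (Cs : ℕ → ℕ) (δ : ℝ) : (n : ℕ) → Set (Fin n → K) → Prop
  | 0, _ => True
  | n + 1, X =>
    (∀ p, HasMoreThan (Cs n) (lastFibre X p) →
        δ * (Fintype.card K : ℝ) ≤ ((lastFibre X p).ncard : ℝ)) ∧
      GoodThresholds Cs δ n (cfinBase (Cs n) X) ∧ GoodThresholds Cs δ n (cinfBase (Cs n) X)

/-- The constant `M_n = ∏_{k<n} (Cs k + 1)` of the upper counting estimate. [folklore] -/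
def thresholdBound (Cs : ℕ → ℕ) : ℕ → ℕ
  | 0 => 1
  | n + 1 => (Cs n + 1) * thresholdBound Cs n

end Defs

section Basic

variable {n : ℕ}

/-- Membership in the thresholded base of small fibres. [folklore] -/
@[simp] theorem mem_cfinBase (C : ℕ) (X : Set (Fin (n + 1) → K)) (p : Fin n → K) :
    p ∈ cfinBase C X ↔ (lastFibre X p).Nonempty ∧ ¬ HasMoreThan C (lastFibre X p) := Iff.rfl

/-- Membership in the thresholded base of large fibres. [folklore] -/
@[simp] theorem mem_cinfBase (C : ℕ) (X : Set (Fin (n + 1) → K)) (p : Fin n → K) :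
    p ∈ cinfBase C X ↔ HasMoreThan C (lastFibre X p) := Iff.rfl

/-- Unfolding of the thresholded dimension in `K^0`. [folklore] -/
theorem cDimAtLeast_zero_level (Cs : ℕ → ℕ) (X : Set (Fin 0 → K)) (e : ℕ) :
    CDimAtLeast Cs 0 X e ↔ X.Nonempty ∧ e = 0 := Iff.rfl

/-- Unfolding of the thresholded dimension in `K^{n+1}`. [folklore] -/
theorem cDimAtLeast_succ (Cs : ℕ → ℕ) (X : Set (Fin (n + 1) → K)) (e : ℕ) :
    CDimAtLeast Cs (n + 1) X e ↔
      CDimAtLeast Cs n (cfinBase (Cs n) X) e ∨ CDimAtLeast Cs n (cinfBase (Cs n) X) (e - 1) :=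
  Iff.rfl

/-- Unfolding of good thresholds in `K^{n+1}`. [folklore] -/
theorem goodThresholds_succ [Fintype K] (Cs : ℕ → ℕ) (δ : ℝ) (X : Set (Fin (n + 1) → K)) :
    GoodThresholds Cs δ (n + 1) X ↔
      (∀ p, HasMoreThan (Cs n) (lastFibre X p) →
          δ * (Fintype.card K : ℝ) ≤ ((lastFibre X p).ncard : ℝ)) ∧
        GoodThresholds Cs δ n (cfinBase (Cs n) X) ∧ GoodThresholds Cs δ n (cinfBase (Cs n) X) :=
  Iff.rfl

/-- Good thresholds in `K^0` (no condition). [folklore] -/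
theorem goodThresholds_zero_level [Fintype K] (Cs : ℕ → ℕ) (δ : ℝ) (X : Set (Fin 0 → K)) :
    GoodThresholds Cs δ 0 X := trivial

/-- Unfolding of the bound `M_{n+1} = (C_n + 1) M_n`. [folklore] -/
theorem thresholdBound_succ (Cs : ℕ → ℕ) (n : ℕ) :
    thresholdBound Cs (n + 1) = (Cs n + 1) * thresholdBound Cs n := rfl

/-- `M_0 = 1`. [folklore] -/
theorem thresholdBound_zero (Cs : ℕ → ℕ) : thresholdBound Cs 0 = 1 := rfl

/-- `1 ≤ M_n`. [folklore] -/
theorem one_le_thresholdBound (Cs : ℕ → ℕ) : ∀ n, 1 ≤ thresholdBound Cs n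
  | 0 => le_rfl
  | n + 1 => by
    rw [thresholdBound_succ]
    exact one_le_mul (Nat.le_add_left 1 _) (one_le_thresholdBound Cs n)

/-- Every point of `X` lies over a point of `cfinBase C X ∪ cinfBase C X`. [folklore] -/
theorem init_mem_cfinBase_union_cinfBase (C : ℕ) {X : Set (Fin (n + 1) → K)}
    {x : Fin (n + 1) → K} (hx : x ∈ X) : Fin.init x ∈ cfinBase C X ∪ cinfBase C X := by
  have hne : (lastFibre X (Fin.init x)).Nonempty :=
    ⟨x (Fin.last n), by rw [mem_lastFibre, Fin.snoc_init_self]; exact hx⟩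
  by_cases h : HasMoreThan C (lastFibre X (Fin.init x))
  · exact Or.inr h
  · exact Or.inl ⟨hne, h⟩

/-- **Thresholded dimension `≥ 0` means nonempty.** [folklore] -/
theorem cDimAtLeast_zero_iff (Cs : ℕ → ℕ) :
    ∀ {n : ℕ} (X : Set (Fin n → K)), CDimAtLeast Cs n X 0 ↔ X.Nonempty
  | 0, X => by rw [cDimAtLeast_zero_level]; exact ⟨fun h => h.1, fun h => ⟨h, rfl⟩⟩
  | n + 1, X => by
    rw [cDimAtLeast_succ, Nat.zero_sub, cDimAtLeast_zero_iff, cDimAtLeast_zero_iff]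
    constructor
    · rintro (⟨p, hp⟩ | ⟨p, hp⟩)
      · obtain ⟨t, ht⟩ := hp.1
        exact ⟨_, ht⟩
      · obtain ⟨t, ht⟩ := hp.nonempty
        exact ⟨_, ht⟩
    · rintro ⟨x, hx⟩
      rcases init_mem_cfinBase_union_cinfBase (Cs n) hx with h | h
      · exact Or.inl ⟨_, h⟩
      · exact Or.inr ⟨_, h⟩

/-- **Thresholded dimension is at most the number of coordinates.** [folklore] -/
theorem CDimAtLeast.le {Cs : ℕ → ℕ} :
    ∀ {n : ℕ} {X : Set (Fin n → K)} {e : ℕ}, CDimAtLeast Cs n X e → e ≤ n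
  | 0, _, _, h => h.2.le
  | n + 1, _, e, h => by
    rcases (cDimAtLeast_succ _ _ _).1 h with h | h
    · exact (CDimAtLeast.le h).trans (Nat.le_succ n)
    · have := CDimAtLeast.le h
      omega

/-- **Downward closure in `e`** of the thresholded dimension. [folklore] -/
theorem CDimAtLeast.anti {Cs : ℕ → ℕ} : ∀ {n : ℕ} {X : Set (Fin n → K)} {e e' : ℕ},
    CDimAtLeast Cs n X e → e' ≤ e → CDimAtLeast Cs n X e'
  | 0, _, _, _, h, hle => ⟨h.1, Nat.eq_zero_of_le_zero (h.2 ▸ hle)⟩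
  | n + 1, X, e, e', h, hle => by
    rcases (cDimAtLeast_succ _ _ _).1 h with h | h
    · exact Or.inl (h.anti hle)
    · exact Or.inr (h.anti (Nat.sub_le_sub_right hle 1))

/-- A set of some thresholded dimension is nonempty. [folklore] -/
theorem CDimAtLeast.nonempty {Cs : ℕ → ℕ} {X : Set (Fin n → K)} {e : ℕ}
    (h : CDimAtLeast Cs n X e) : X.Nonempty :=
  (cDimAtLeast_zero_iff Cs X).1 (h.anti (Nat.zero_le e))

/-- `CDimAtLeast Cs n X e` only depends on the thresholds `Cs k`, `k < n`. [folklore] -/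
theorem cDimAtLeast_congr {Cs Cs' : ℕ → ℕ} :
    ∀ {n : ℕ}, (∀ k, k < n → Cs k = Cs' k) → ∀ (X : Set (Fin n → K)) (e : ℕ),
      (CDimAtLeast Cs n X e ↔ CDimAtLeast Cs' n X e)
  | 0, _, X, e => Iff.rfl
  | n + 1, h, X, e => by
    have hn : Cs n = Cs' n := h n (Nat.lt_succ_self n)
    have h' : ∀ k, k < n → Cs k = Cs' k := fun k hk => h k (Nat.lt_succ_of_lt hk)
    rw [cDimAtLeast_succ, cDimAtLeast_succ, hn, cDimAtLeast_congr h', cDimAtLeast_congr h']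

/-- `GoodThresholds Cs δ n X` only depends on the thresholds `Cs k`, `k < n`. [folklore] -/
theorem goodThresholds_congr [Fintype K] {Cs Cs' : ℕ → ℕ} {δ : ℝ} :
    ∀ {n : ℕ}, (∀ k, k < n → Cs k = Cs' k) → ∀ (X : Set (Fin n → K)),
      (GoodThresholds Cs δ n X ↔ GoodThresholds Cs' δ n X)
  | 0, _, X => Iff.rfl
  | n + 1, h, X => by
    have hn : Cs n = Cs' n := h n (Nat.lt_succ_self n)
    have h' : ∀ k, k < n → Cs k = Cs' k := fun k hk => h k (Nat.lt_succ_of_lt hk)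
    rw [goodThresholds_succ, goodThresholds_succ, hn, goodThresholds_congr h',
      goodThresholds_congr h']

/-- Good thresholds stay good for a smaller `δ`. [folklore] -/
theorem GoodThresholds.anti [Fintype K] {Cs : ℕ → ℕ} {δ δ' : ℝ} :
    ∀ {n : ℕ} {X : Set (Fin n → K)}, GoodThresholds Cs δ n X → δ' ≤ δ → GoodThresholds Cs δ' n X
  | 0, _, _, _ => trivial
  | n + 1, X, h, hle => by
    rw [goodThresholds_succ] at h ⊢
    refine ⟨fun p hp => (mul_le_mul_of_nonneg_right hle (Nat.cast_nonneg _)).trans (h.1 p hp),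
      h.2.1.anti hle, h.2.2.anti hle⟩

/-- A point outside both thresholded bases has empty fibre. [folklore] -/
theorem lastFibre_eq_empty_of_notMem {C : ℕ} {X : Set (Fin (n + 1) → K)} {p : Fin n → K}
    (h0 : p ∉ cfinBase C X) (h1 : p ∉ cinfBase C X) : lastFibre X p = ∅ := by
  rw [mem_cinfBase] at h1
  rw [mem_cfinBase, not_and_or, not_not] at h0
  rcases h0 with h0 | h0
  · exact Set.not_nonempty_iff_eq_empty.1 h0
  · exact absurd h0 h1

end Basic

/-! ### Counting in a finite field -/

section Counting

variable [Fintype K] {n : ℕ}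

/-- **Fibre decomposition of the point count**: `|X| = Σ_p |X_p|` over the base `K^n`.
[folklore] -/
theorem ncard_eq_sum_ncard_lastFibre (X : Set (Fin (n + 1) → K)) :
    X.ncard = ∑ p : Fin n → K, (lastFibre X p).ncard := by
  classical
  rw [Set.ncard_eq_toFinset_card' X,
    Finset.card_eq_sum_card_fiberwise (f := Fin.init) (t := Finset.univ) fun _ _ =>
      Finset.mem_coe.2 (Finset.mem_univ _)]
  refine Finset.sum_congr rfl fun p _ => ?_
  rw [Set.ncard_eq_toFinset_card' (lastFibre X p)]
  refine Finset.card_nbij' (fun x => x (Fin.last n)) (fun t => Fin.snoc p t) ?_ ?_ ?_ ?_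
  · intro x hx
    rw [Finset.mem_coe, Finset.mem_filter, Set.mem_toFinset] at hx
    rw [Finset.mem_coe, Set.mem_toFinset, mem_lastFibre, ← hx.2, Fin.snoc_init_self]
    exact hx.1
  · intro t ht
    rw [Finset.mem_coe, Set.mem_toFinset, mem_lastFibre] at ht
    rw [Finset.mem_coe, Finset.mem_filter, Set.mem_toFinset]
    exact ⟨ht, Fin.init_snoc _ _⟩
  · intro x hx
    rw [Finset.mem_coe, Finset.mem_filter] at hx
    dsimp only
    rw [← hx.2, Fin.snoc_init_self]
  · intro t _
    exact Fin.snoc_last _ _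

/-- A fibre of cardinality bounded by the threshold, over the base of small fibres. [folklore] -/
theorem ncard_lastFibre_le_of_mem_cfinBase {C : ℕ} {X : Set (Fin (n + 1) → K)} {p : Fin n → K}
    (hp : p ∈ cfinBase C X) : (lastFibre X p).ncard ≤ C :=
  (not_hasMoreThan_iff_ncard_le (Set.toFinite _)).1 hp.2

/-- Every fibre has at most `q` points. [folklore] -/
theorem ncard_lastFibre_le_card (X : Set (Fin (n + 1) → K)) (p : Fin n → K) :
    (lastFibre X p).ncard ≤ Fintype.card K := by
  rw [← Nat.card_eq_fintype_card]
  exact Set.ncard_le_card _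

/-- The point count of a set is the sum of the indicator over the ambient finite type.
[folklore] -/
theorem ncard_eq_sum_ite (B : Set (Fin n → K)) [DecidablePred (· ∈ B)] :
    (B.ncard : ℝ) = ∑ p : Fin n → K, (if p ∈ B then (1 : ℝ) else 0) := by
  classical
  rw [Finset.sum_boole, Set.ncard_eq_toFinset_card' B]
  congr 2
  ext p
  simp

/-- **Lower counting estimate.**  Over a finite field with `q` elements, for good thresholds
with `0 < δ ≤ 1`: `CDimAtLeast Cs n X e → δ^n q^e ≤ |X|`. [folklore]
(cf. [ChatzidakisVanDenDriesMacintyre1992, Main Theorem]) -/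
theorem le_ncard_of_cDimAtLeast [Nonempty K] {Cs : ℕ → ℕ} {δ : ℝ} (hδ : 0 < δ) (hδ1 : δ ≤ 1) :
    ∀ {n : ℕ} {X : Set (Fin n → K)} {e : ℕ}, GoodThresholds Cs δ n X → CDimAtLeast Cs n X e →
      δ ^ n * (Fintype.card K : ℝ) ^ e ≤ (X.ncard : ℝ)
  | 0, X, e, _, h => by
    obtain ⟨hne, rfl⟩ := h
    rw [pow_zero, pow_zero, one_mul]
    have h1 : 1 ≤ X.ncard := (Set.ncard_pos (Set.toFinite X)).2 hne
    exact_mod_cast h1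
  | n + 1, X, e, hgood, h => by
    classical
    rw [goodThresholds_succ] at hgood
    obtain ⟨hfib, hgood0, hgood1⟩ := hgood
    have hq0 : (0 : ℝ) ≤ (Fintype.card K : ℝ) := Nat.cast_nonneg _
    have hq1 : (1 : ℝ) ≤ (Fintype.card K : ℝ) := by exact_mod_cast Fintype.card_pos
    have hδn : (0 : ℝ) ≤ δ ^ n := pow_nonneg hδ.le n
    have hsum : (X.ncard : ℝ) = ∑ p : Fin n → K, ((lastFibre X p).ncard : ℝ) := by
      rw [ncard_eq_sum_ncard_lastFibre X]; push_cast; rfl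
    rcases (cDimAtLeast_succ _ _ _).1 h with h | h
    · -- the base of small nonempty fibres has dimension `≥ e`
      have hIH := le_ncard_of_cDimAtLeast hδ hδ1 hgood0 h
      set B := cfinBase (Cs n) X with hB
      have hBle : (B.ncard : ℝ) ≤ (X.ncard : ℝ) := by
        rw [hsum, ncard_eq_sum_ite B]
        refine Finset.sum_le_sum fun p _ => ?_
        split_ifs with hp
        · exact_mod_cast (Set.ncard_pos (Set.toFinite _)).2 hp.1
        · exact Nat.cast_nonneg _
      calc δ ^ (n + 1) * (Fintype.card K : ℝ) ^ e
          ≤ δ ^ n * (Fintype.card K : ℝ) ^ e := by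
            apply mul_le_mul_of_nonneg_right _ (pow_nonneg hq0 e)
            rw [pow_succ]
            exact mul_le_of_le_one_right hδn hδ1
        _ ≤ (B.ncard : ℝ) := hIH
        _ ≤ (X.ncard : ℝ) := hBle
    · -- the base of large fibres has dimension `≥ e - 1`, each fibre has `≥ δ q` points
      have hIH := le_ncard_of_cDimAtLeast hδ hδ1 hgood1 h
      set B := cinfBase (Cs n) X with hB
      have hBle : (B.ncard : ℝ) * (δ * (Fintype.card K : ℝ)) ≤ (X.ncard : ℝ) := by
        rw [hsum, ncard_eq_sum_ite B, Finset.sum_mul]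
        refine Finset.sum_le_sum fun p _ => ?_
        split_ifs with hp
        · rw [one_mul]; exact hfib p hp
        · rw [zero_mul]; exact Nat.cast_nonneg _
      have hpow : (Fintype.card K : ℝ) ^ e ≤ (Fintype.card K : ℝ) ^ (e - 1) * Fintype.card K := by
        rcases Nat.eq_zero_or_pos e with rfl | he
        · simp only [pow_zero, Nat.zero_sub, one_mul]
          exact hq1
        · rw [← pow_succ, Nat.sub_add_cancel he]
      calc δ ^ (n + 1) * (Fintype.card K : ℝ) ^ e
          ≤ δ ^ (n + 1) * ((Fintype.card K : ℝ) ^ (e - 1) * Fintype.card K) :=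
            mul_le_mul_of_nonneg_left hpow (pow_nonneg hδ.le _)
        _ = δ ^ n * (Fintype.card K : ℝ) ^ (e - 1) * (δ * Fintype.card K) := by ring
        _ ≤ (B.ncard : ℝ) * (δ * Fintype.card K) :=
            mul_le_mul_of_nonneg_right hIH (mul_nonneg hδ.le hq0)
        _ ≤ (X.ncard : ℝ) := hBle

/-- **Upper counting estimate.**  Over a finite field with `q` elements, for good thresholds:
`¬ CDimAtLeast Cs n X (e + 1) → |X| ≤ M_n q^e` with `M_n = thresholdBound Cs n`. [folklore]
(cf. [ChatzidakisVanDenDriesMacintyre1992, Main Theorem]) -/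
theorem ncard_le_of_not_cDimAtLeast [Nonempty K] {Cs : ℕ → ℕ} {δ : ℝ} :
    ∀ {n : ℕ} {X : Set (Fin n → K)} {e : ℕ}, GoodThresholds Cs δ n X →
      ¬ CDimAtLeast Cs n X (e + 1) →
        (X.ncard : ℝ) ≤ (thresholdBound Cs n : ℝ) * (Fintype.card K : ℝ) ^ e
  | 0, X, e, _, _ => by
    have hq1 : (1 : ℝ) ≤ (Fintype.card K : ℝ) := by exact_mod_cast Fintype.card_pos
    have h1 : X.ncard ≤ 1 := by
      calc X.ncard ≤ Nat.card (Fin 0 → K) := Set.ncard_le_card X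
        _ = 1 := by rw [Nat.card_eq_fintype_card, Fintype.card_fun, Fintype.card_fin, pow_zero]
    rw [thresholdBound_zero, Nat.cast_one, one_mul]
    calc (X.ncard : ℝ) ≤ 1 := by exact_mod_cast h1
      _ ≤ (Fintype.card K : ℝ) ^ e := one_le_pow₀ hq1
  | n + 1, X, e, hgood, h => by
    classical
    rw [goodThresholds_succ] at hgood
    obtain ⟨-, hgood0, hgood1⟩ := hgood
    rw [cDimAtLeast_succ, not_or, Nat.add_sub_cancel] at h
    obtain ⟨h0, h1⟩ := h
    have hq0 : (0 : ℝ) ≤ (Fintype.card K : ℝ) := Nat.cast_nonneg _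
    set B₀ := cfinBase (Cs n) X with hB₀
    set B₁ := cinfBase (Cs n) X with hB₁
    -- `|X| ≤ C_n |B₀| + q |B₁|`
    have hX : (X.ncard : ℝ) ≤ (Cs n : ℝ) * B₀.ncard + (Fintype.card K : ℝ) * B₁.ncard := by
      rw [ncard_eq_sum_ncard_lastFibre X, ncard_eq_sum_ite B₀, ncard_eq_sum_ite B₁, Finset.mul_sum,
        Finset.mul_sum, ← Finset.sum_add_distrib]
      push_cast
      refine Finset.sum_le_sum fun p _ => ?_
      by_cases hp1 : p ∈ B₁
      · rw [if_pos hp1]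
        have := ncard_lastFibre_le_card X p
        calc ((lastFibre X p).ncard : ℝ) ≤ Fintype.card K := by exact_mod_cast this
          _ = (Fintype.card K : ℝ) * 1 := (mul_one _).symm
          _ ≤ (Cs n : ℝ) * (if p ∈ B₀ then 1 else 0) + (Fintype.card K : ℝ) * 1 := by
              have : (0 : ℝ) ≤ (Cs n : ℝ) * (if p ∈ B₀ then 1 else 0) := by
                split_ifs <;> simp
              linarith
      · rw [if_neg hp1, mul_zero, add_zero]
        by_cases hp0 : p ∈ B₀
        · rw [if_pos hp0, mul_one]
          exact_mod_cast ncard_lastFibre_le_of_mem_cfinBase hp0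
        · rw [if_neg hp0, mul_zero, lastFibre_eq_empty_of_notMem hp0 hp1, Set.ncard_empty,
            Nat.cast_zero]
    -- the bases are small by induction
    have hB₀ : (B₀.ncard : ℝ) ≤ (thresholdBound Cs n : ℝ) * (Fintype.card K : ℝ) ^ e :=
      ncard_le_of_not_cDimAtLeast hgood0 h0
    have hB₁ : (Fintype.card K : ℝ) * B₁.ncard ≤ (thresholdBound Cs n : ℝ) * (Fintype.card K : ℝ) ^ e := by
      rcases Nat.eq_zero_or_pos e with rfl | he
      · -- `e = 0`: `B₁` is empty
        have hempty : B₁ = ∅ := by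
          by_contra hne
          exact h1 ((cDimAtLeast_zero_iff Cs B₁).2 (Set.nonempty_iff_ne_empty.2 hne))
        rw [hempty, Set.ncard_empty, Nat.cast_zero, mul_zero]
        exact mul_nonneg (Nat.cast_nonneg _) (pow_nonneg hq0 _)
      · obtain ⟨e', rfl⟩ : ∃ e', e = e' + 1 := ⟨e - 1, by omega⟩
        have := ncard_le_of_not_cDimAtLeast hgood1 h1
        calc (Fintype.card K : ℝ) * B₁.ncard
            ≤ (Fintype.card K : ℝ) * ((thresholdBound Cs n : ℝ) * (Fintype.card K : ℝ) ^ e') :=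
              mul_le_mul_of_nonneg_left this hq0
          _ = (thresholdBound Cs n : ℝ) * (Fintype.card K : ℝ) ^ (e' + 1) := by ring
    calc (X.ncard : ℝ) ≤ (Cs n : ℝ) * B₀.ncard + (Fintype.card K : ℝ) * B₁.ncard := hX
      _ ≤ (Cs n : ℝ) * ((thresholdBound Cs n : ℝ) * (Fintype.card K : ℝ) ^ e) +
            (thresholdBound Cs n : ℝ) * (Fintype.card K : ℝ) ^ e :=
          add_le_add (mul_le_mul_of_nonneg_left hB₀ (Nat.cast_nonneg _)) hB₁
      _ = (thresholdBound Cs (n + 1) : ℝ) * (Fintype.card K : ℝ) ^ e := by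
          rw [thresholdBound_succ]; push_cast; ring

/-- **Upper counting estimate for `e = 0`**: a set of thresholded dimension `< 1` has at most
`M_n` points. [folklore] -/
theorem ncard_le_of_not_cDimAtLeast_one [Nonempty K] {Cs : ℕ → ℕ} {δ : ℝ} {X : Set (Fin n → K)}
    (hgood : GoodThresholds Cs δ n X) (h : ¬ CDimAtLeast Cs n X 1) :
    (X.ncard : ℝ) ≤ (thresholdBound Cs n : ℝ) := by
  have := ncard_le_of_not_cDimAtLeast (e := 0) hgood h
  rwa [pow_zero, mul_one] at this

end Counting

end Literature.ModelTheory.PseudofiniteFields
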